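import Summits.Ventures.LatticeQCDFlow.Scoring.GaussVandermondeSecondMoment
import Mathlib.MeasureTheory.Group.Integral
import HarnessLib

/-!
# The trace of the Gaussian–Vandermonde law is exactly Gaussian: `∫ e^{tΣφ_b} e^{−Σφ²/2} Δ² dφ = e^{Nt²/2} M_N` and `∫ (Σ_b φ_b)² e^{−Σφ²/2} Δ² dφ = N · M_N`

HONEST FRAMING: exact (Metropolis-corrected) sampling algorithms for lattice gauge theory;
figures of merit are autocorrelation/cost numbers at stated couplings and volumes; no
continuum-physics claim.

Venture `LatticeQCDFlow` (cell pub-lqcd), sub-topic `Scoring`; FANOUT row 5 (`s0-sun-a`), GEN-20.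
NEW WORK of the cell (placement rule).  Input of the weak-coupling law of the `U(1)`-phase of the `U(N)` plaquette (the 2-d
`U(N)` topological density `arg det U_p`, sibling file `UNDeterminantPhaseWeakCoupling`: `β ⟨(arg det U_p)²⟩_β → N`).  The
Vandermonde factor `Δ(φ)² = Π_{j≺k}(φ_j − φ_k)²` is invariant under the diagonal translation `φ ↦ φ + t·(1,…,1)`, and Lebesgue
measure on `ℝ^N` is translation invariant; completing the square:

* §1 **`integral_exp_mul_sum_gaussVandermonde`** — `∫ e^{tΣ_bφ_b} e^{−Σφ_b²/2} Δ² dφ = e^{Nt²/2} · M_N` for every real `t`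
  (the sum of the "eigenvalues" is `N(0, N)` under the normalised law: GUE `tr H ~ N(0, N)`), and the first-moment form
  **`integral_sum_mul_exp_mul_sum_gaussVandermonde`** — `∫ (Σφ) e^{tΣφ} e^{−Σφ²/2} Δ² dφ = N t e^{Nt²/2} · M_N`
  (translation of the odd integrand `(Σφ) e^{−Σφ²/2}Δ²`, whose integral vanishes);
* §2 **`integral_sumSq_gaussVandermonde`** — `∫ (Σ_bφ_b)² e^{−Σφ²/2} Δ² dφ = N · M_N` (differentiating §1's first-moment
  form at `t = 0` under the integral sign).

No `def`, nothing cited as a fact, 0 sorry.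
-/

noncomputable section

open Real MeasureTheory Filter Topology Finset
open Literature.RepresentationTheory.CompactGroups.WeylIntegration (OD enum)

namespace Summit.Ventures.LatticeQCDFlow.Scoring

section TraceMoment

variable {n : Type*} [Fintype n]

/-! ### 1. The moment generating function of the trace, by translation -/

/-- Completing the square under the diagonal translation:
`e^{−Σ(φ_b + t)²/2} Δ(φ + t·1)² = e^{−Nt²/2} e^{−tΣφ} · e^{−Σφ²/2} Δ(φ)²`. -/
theorem gaussVandermonde_translate (t : ℝ) (φ : n → ℝ) :
    Real.exp (∑ b, -((t + φ b) ^ 2 / 2)) * ∏ p : OD n, ((t + φ p.1.1) - (t + φ p.1.2)) ^ 2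
      = Real.exp (-(Fintype.card n * t ^ 2 / 2)) * Real.exp (-(t * ∑ b, φ b)) *
        (Real.exp (∑ b, -(φ b ^ 2 / 2)) * ∏ p : OD n, (φ p.1.1 - φ p.1.2) ^ 2) := by
  have hprod : ∏ p : OD n, ((t + φ p.1.1) - (t + φ p.1.2)) ^ 2 = ∏ p : OD n, (φ p.1.1 - φ p.1.2) ^ 2 :=
    Finset.prod_congr rfl fun p _ => by ring
  rw [hprod, ← mul_assoc, ← Real.exp_add, ← Real.exp_add]
  congr 2
  have : ∑ b, -((t + φ b) ^ 2 / 2) = ∑ b, (-(t ^ 2 / 2) + (-(t * φ b)) + -(φ b ^ 2 / 2)) :=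
    Finset.sum_congr rfl fun b _ => by ring
  rw [this, Finset.sum_add_distrib, Finset.sum_add_distrib, Finset.sum_const, Finset.card_univ, nsmul_eq_mul,
    Finset.sum_neg_distrib, Finset.mul_sum]
  ring

/-- **`∫ e^{tΣ_bφ_b} e^{−Σφ²/2} Π_{j≺k}(φ_j − φ_k)² dφ = e^{Nt²/2} · M_N`**: under the normalised Gaussian–Vandermonde law the
sum `Σ_b φ_b` is centred Gaussian with variance `N`. -/
theorem integral_exp_mul_sum_gaussVandermonde (t : ℝ) :
    ∫ φ : n → ℝ, Real.exp (t * ∑ b, φ b) * (Real.exp (∑ b, -(φ b ^ 2 / 2)) * ∏ p : OD n, (φ p.1.1 - φ p.1.2) ^ 2)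
      = Real.exp (Fintype.card n * t ^ 2 / 2) *
        ∫ φ : n → ℝ, Real.exp (∑ b, -(φ b ^ 2 / 2)) * ∏ p : OD n, (φ p.1.1 - φ p.1.2) ^ 2 := by
  set G : (n → ℝ) → ℝ := fun φ => Real.exp (∑ b, -(φ b ^ 2 / 2)) * ∏ p : OD n, (φ p.1.1 - φ p.1.2) ^ 2 with hG
  -- translate by `−t·1`
  have htr := integral_add_left_eq_self (μ := (volume : Measure (n → ℝ))) G (fun _ => -t)
  have hpt : ∀ φ : n → ℝ, G ((fun _ => -t) + φ) = Real.exp (-(Fintype.card n * t ^ 2 / 2)) *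
      (Real.exp (t * ∑ b, φ b) * G φ) := by
    intro φ
    have h := gaussVandermonde_translate (-t) φ
    simp only [hG, Pi.add_apply]
    rw [h]
    have : Real.exp (-(-t * ∑ b, φ b)) = Real.exp (t * ∑ b, φ b) := by rw [neg_mul, neg_neg]
    rw [this]
    ring
  simp_rw [hpt] at htr
  rw [integral_const_mul] at htr
  simp only [hG] at htr
  have hE : Real.exp (-(Fintype.card n * t ^ 2 / 2)) ≠ 0 := (Real.exp_pos _).ne'
  calc (∫ φ : n → ℝ, Real.exp (t * ∑ b, φ b) * (Real.exp (∑ b, -(φ b ^ 2 / 2)) * ∏ p : OD n, (φ p.1.1 - φ p.1.2) ^ 2))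
      = (Real.exp (-(Fintype.card n * t ^ 2 / 2)))⁻¹ * (Real.exp (-(Fintype.card n * t ^ 2 / 2)) *
          ∫ φ : n → ℝ, Real.exp (t * ∑ b, φ b) * (Real.exp (∑ b, -(φ b ^ 2 / 2)) * ∏ p : OD n, (φ p.1.1 - φ p.1.2) ^ 2)) := by
        field_simp
    _ = (Real.exp (-(Fintype.card n * t ^ 2 / 2)))⁻¹ *
          ∫ φ : n → ℝ, Real.exp (∑ b, -(φ b ^ 2 / 2)) * ∏ p : OD n, (φ p.1.1 - φ p.1.2) ^ 2 := by rw [htr]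
    _ = Real.exp (Fintype.card n * t ^ 2 / 2) *
          ∫ φ : n → ℝ, Real.exp (∑ b, -(φ b ^ 2 / 2)) * ∏ p : OD n, (φ p.1.1 - φ p.1.2) ^ 2 := by
        rw [Real.exp_neg, inv_inv]

/-- The odd integrand `(Σφ) e^{−Σφ²/2} Δ²` integrates to zero. -/
theorem integral_sum_mul_gaussVandermonde :
    ∫ φ : n → ℝ, (∑ b, φ b) * (Real.exp (∑ b, -(φ b ^ 2 / 2)) * ∏ p : OD n, (φ p.1.1 - φ p.1.2) ^ 2) = 0 := by
  set H : (n → ℝ) → ℝ := fun φ => (∑ b, φ b) * (Real.exp (∑ b, -(φ b ^ 2 / 2)) * ∏ p : OD n, (φ p.1.1 - φ p.1.2) ^ 2)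
    with hH
  have hcomp := Measure.integral_comp_smul volume H (-1 : ℝ)
  rw [Module.finrank_fintype_fun_eq_card, smul_eq_mul] at hcomp
  have hneg : ∀ φ : n → ℝ, H ((-1 : ℝ) • φ) = -H φ := by
    intro φ
    simp only [hH, Pi.smul_apply, smul_eq_mul, neg_mul, one_mul]
    have h1 : ∑ b, -φ b = -∑ b, φ b := Finset.sum_neg_distrib ..
    have h2 : ∑ b, -((-φ b) ^ 2 / 2) = ∑ b, -(φ b ^ 2 / 2) := Finset.sum_congr rfl fun b _ => by ring
    have h3 : ∏ p : OD n, (-φ p.1.1 - -φ p.1.2) ^ 2 = ∏ p : OD n, (φ p.1.1 - φ p.1.2) ^ 2 :=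
      Finset.prod_congr rfl fun p _ => by ring
    rw [h1, h2, h3]
    ring
  simp_rw [hneg] at hcomp
  rw [integral_neg] at hcomp
  have habs : |((-1 : ℝ) ^ Fintype.card n)⁻¹| = 1 := by
    rw [abs_inv, abs_pow, abs_neg, abs_one, one_pow, inv_one]
  rw [habs, one_mul] at hcomp
  show ∫ φ, H φ = 0
  linarith

/-- **`∫ (Σφ) e^{tΣφ} e^{−Σφ²/2} Δ² dφ = N t e^{Nt²/2} · M_N`** for every real `t` (translation of the odd integrand). -/
theorem integral_sum_mul_exp_mul_sum_gaussVandermonde (t : ℝ) :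
    ∫ φ : n → ℝ, (∑ b, φ b) * Real.exp (t * ∑ b, φ b) *
        (Real.exp (∑ b, -(φ b ^ 2 / 2)) * ∏ p : OD n, (φ p.1.1 - φ p.1.2) ^ 2)
      = Fintype.card n * t * Real.exp (Fintype.card n * t ^ 2 / 2) *
        ∫ φ : n → ℝ, Real.exp (∑ b, -(φ b ^ 2 / 2)) * ∏ p : OD n, (φ p.1.1 - φ p.1.2) ^ 2 := by
  set G : (n → ℝ) → ℝ := fun φ => Real.exp (∑ b, -(φ b ^ 2 / 2)) * ∏ p : OD n, (φ p.1.1 - φ p.1.2) ^ 2 with hG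
  set H : (n → ℝ) → ℝ := fun φ => (∑ b, φ b) * G φ with hH
  have htr := integral_add_left_eq_self (μ := (volume : Measure (n → ℝ))) H (fun _ => -t)
  have h0 : ∫ φ, H φ = 0 := integral_sum_mul_gaussVandermonde
  have hpt : ∀ φ : n → ℝ, H ((fun _ => -t) + φ) = Real.exp (-(Fintype.card n * t ^ 2 / 2)) *
      ((∑ b, φ b) * Real.exp (t * ∑ b, φ b) * G φ)
      - Fintype.card n * t * Real.exp (-(Fintype.card n * t ^ 2 / 2)) * (Real.exp (t * ∑ b, φ b) * G φ) := by
    intro φ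
    have h := gaussVandermonde_translate (-t) φ
    simp only [hH, hG, Pi.add_apply]
    rw [h]
    have e1 : Real.exp (-(-t * ∑ b, φ b)) = Real.exp (t * ∑ b, φ b) := by rw [neg_mul, neg_neg]
    have e2 : ∑ b, (-t + φ b) = -(Fintype.card n * t) + ∑ b, φ b := by
      rw [Finset.sum_add_distrib, Finset.sum_const, Finset.card_univ, nsmul_eq_mul, mul_neg]
    have e3 : Real.exp (-(Fintype.card n * (-t) ^ 2 / 2)) = Real.exp (-(Fintype.card n * t ^ 2 / 2)) := by rw [neg_sq]
    rw [e1, e2, e3]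
    ring
  simp_rw [hpt] at htr
  -- integrability of the two pieces (Gaussian domination)
  have hK : ∀ φ : n → ℝ, Real.exp (t * ∑ b, φ b) * Real.exp (∑ b, -(φ b ^ 2 / 2))
      ≤ Real.exp (Fintype.card n * t ^ 2) * ∏ b, Real.exp (-(2 / π ^ 2 * φ b ^ 2)) := by
    intro φ
    rw [← Real.exp_add, ← Real.exp_sum, ← Real.exp_add]
    refine Real.exp_le_exp.2 ?_
    have hπ : 2 / π ^ 2 ≤ 1 / 4 := by
      rw [div_le_div_iff₀ (by positivity) (by norm_num)]
      nlinarith [Real.pi_gt_three]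
    have hterm : ∀ b, t * φ b + -(φ b ^ 2 / 2) ≤ t ^ 2 + -(2 / π ^ 2 * φ b ^ 2) := fun b => by
      nlinarith [sq_nonneg (φ b / 2 - t), sq_nonneg (φ b), hπ]
    calc t * ∑ b, φ b + ∑ b, -(φ b ^ 2 / 2) = ∑ b, (t * φ b + -(φ b ^ 2 / 2)) := by
          rw [Finset.mul_sum, ← Finset.sum_add_distrib]
      _ ≤ ∑ b, (t ^ 2 + -(2 / π ^ 2 * φ b ^ 2)) := Finset.sum_le_sum fun b _ => hterm b
      _ = Fintype.card n * t ^ 2 + ∑ b, -(2 / π ^ 2 * φ b ^ 2) := by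
          rw [Finset.sum_add_distrib, Finset.sum_const, Finset.card_univ, nsmul_eq_mul]
  have hint1 : Integrable (fun φ : n → ℝ => Real.exp (t * ∑ b, φ b) * G φ) := by
    refine Integrable.mono' ((integrable_laplaceBound (n := n)).const_mul (Real.exp (Fintype.card n * t ^ 2)))
      (by simp only [hG]; fun_prop : Continuous fun φ : n → ℝ => Real.exp (t * ∑ b, φ b) * G φ).aestronglyMeasurable
      (Eventually.of_forall fun φ => ?_)
    simp only [hG]
    rw [Real.norm_eq_abs, abs_of_nonneg (mul_nonneg (Real.exp_nonneg _) (mul_nonneg (Real.exp_nonneg _)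
      (Finset.prod_nonneg fun p _ => sq_nonneg _))), ← mul_assoc]
    have h := mul_prod_le_laplaceBound φ (le_refl (∏ b, Real.exp (-(2 / π ^ 2 * φ b ^ 2))))
      (fun p => sq_nonneg _) (fun p => le_rfl)
    calc Real.exp (t * ∑ b, φ b) * Real.exp (∑ b, -(φ b ^ 2 / 2)) * ∏ p : OD n, (φ p.1.1 - φ p.1.2) ^ 2
        ≤ (Real.exp (Fintype.card n * t ^ 2) * ∏ b, Real.exp (-(2 / π ^ 2 * φ b ^ 2))) *
          ∏ p : OD n, (φ p.1.1 - φ p.1.2) ^ 2 :=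
          mul_le_mul_of_nonneg_right (hK φ) (Finset.prod_nonneg fun p _ => sq_nonneg _)
      _ = Real.exp (Fintype.card n * t ^ 2) * ((∏ b, Real.exp (-(2 / π ^ 2 * φ b ^ 2))) *
          ∏ p : OD n, (φ p.1.1 - φ p.1.2) ^ 2) := by ring
      _ ≤ Real.exp (Fintype.card n * t ^ 2) * (2 ^ Fintype.card (OD n) *
          ∏ b, (Real.exp (-(2 / π ^ 2 * φ b ^ 2)) * (1 + φ b ^ 2) ^ Fintype.card (OD n))) :=
          mul_le_mul_of_nonneg_left h (Real.exp_nonneg _)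
  have hint2 : Integrable (fun φ : n → ℝ => (∑ b, φ b) * Real.exp (t * ∑ b, φ b) * G φ) := by
    refine Integrable.mono' ((integrable_gaussPolyBound (n := n) (2 ^ Fintype.card (OD n)) (Fintype.card (OD n) + 1)).const_mul
      (Fintype.card n * Real.exp (Fintype.card n * t ^ 2)))
      (by simp only [hG]; fun_prop : Continuous fun φ : n → ℝ => (∑ b, φ b) * Real.exp (t * ∑ b, φ b) * G φ).aestronglyMeasurable
      (Eventually.of_forall fun φ => ?_)
    simp only [hG]
    rw [Real.norm_eq_abs, abs_mul, abs_mul, abs_of_nonneg (Real.exp_nonneg _), abs_of_nonneg (mul_nonneg (Real.exp_nonneg _)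
      (Finset.prod_nonneg fun p _ => sq_nonneg _))]
    -- `|Σφ| ≤ N Π(1+φ²)` (crudely: `|φ_b| ≤ 1 + φ_b² ≤ Π(1+φ²)`)
    have hS : |∑ b, φ b| ≤ Fintype.card n * ∏ b, (1 + φ b ^ 2) := by
      calc |∑ b, φ b| ≤ ∑ b, |φ b| := Finset.abs_sum_le_sum_abs _ _
        _ ≤ ∑ _b : n, ∏ b, (1 + φ b ^ 2) := Finset.sum_le_sum fun b _ => by
            have h1 : |φ b| ≤ 1 + φ b ^ 2 := by nlinarith [abs_nonneg (φ b), sq_abs (φ b), sq_nonneg (|φ b| - 1)]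
            refine h1.trans ?_
            classical
            rw [← Finset.mul_prod_erase _ _ (Finset.mem_univ b)]
            have hP : 1 ≤ ∏ k ∈ Finset.univ.erase b, (1 + φ k ^ 2) :=
              Finset.one_le_prod fun k _ => by nlinarith [sq_nonneg (φ k)]
            nlinarith [sq_nonneg (φ b)]
        _ = Fintype.card n * ∏ b, (1 + φ b ^ 2) := by simp
    have h := mul_prod_le_laplaceBound φ (le_refl (∏ b, Real.exp (-(2 / π ^ 2 * φ b ^ 2))))
      (fun p => sq_nonneg _) (fun p => le_rfl)
    calc |∑ b, φ b| * Real.exp (t * ∑ b, φ b) * (Real.exp (∑ b, -(φ b ^ 2 / 2)) * ∏ p : OD n, (φ p.1.1 - φ p.1.2) ^ 2)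
        = |∑ b, φ b| * ((Real.exp (t * ∑ b, φ b) * Real.exp (∑ b, -(φ b ^ 2 / 2))) *
            ∏ p : OD n, (φ p.1.1 - φ p.1.2) ^ 2) := by ring
      _ ≤ (Fintype.card n * ∏ b, (1 + φ b ^ 2)) * ((Real.exp (Fintype.card n * t ^ 2) *
            ∏ b, Real.exp (-(2 / π ^ 2 * φ b ^ 2))) * ∏ p : OD n, (φ p.1.1 - φ p.1.2) ^ 2) :=
          mul_le_mul hS (mul_le_mul_of_nonneg_right (hK φ) (Finset.prod_nonneg fun p _ => sq_nonneg _))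
            (mul_nonneg (mul_nonneg (Real.exp_nonneg _) (Real.exp_nonneg _)) (Finset.prod_nonneg fun p _ => sq_nonneg _))
            (by positivity)
      _ = Fintype.card n * Real.exp (Fintype.card n * t ^ 2) * ((∏ b, (1 + φ b ^ 2)) *
            ((∏ b, Real.exp (-(2 / π ^ 2 * φ b ^ 2))) * ∏ p : OD n, (φ p.1.1 - φ p.1.2) ^ 2)) := by ring
      _ ≤ Fintype.card n * Real.exp (Fintype.card n * t ^ 2) * ((∏ b, (1 + φ b ^ 2)) *
            (2 ^ Fintype.card (OD n) * ∏ b, (Real.exp (-(2 / π ^ 2 * φ b ^ 2)) * (1 + φ b ^ 2) ^ Fintype.card (OD n)))) :=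
          mul_le_mul_of_nonneg_left (mul_le_mul_of_nonneg_left h (Finset.prod_nonneg fun b _ => by positivity)) (by positivity)
      _ = Fintype.card n * Real.exp (Fintype.card n * t ^ 2) * (2 ^ Fintype.card (OD n) *
            ∏ b, (Real.exp (-(2 / π ^ 2 * φ b ^ 2)) * (1 + φ b ^ 2) ^ (Fintype.card (OD n) + 1))) := by
          rw [mul_left_comm (∏ b, (1 + φ b ^ 2)), ← Finset.prod_mul_distrib]
          congr 2
          exact Finset.prod_congr rfl fun b _ => by ring
  rw [integral_sub (hint2.const_mul _) (hint1.const_mul _), integral_const_mul, integral_const_mul, h0] at htr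
  have hM := integral_exp_mul_sum_gaussVandermonde (n := n) t
  simp only [hG] at htr ⊢
  rw [hM] at htr
  have hE : Real.exp (-(Fintype.card n * t ^ 2 / 2)) ≠ 0 := (Real.exp_pos _).ne'
  -- `htr : e^{−c} X − N t e^{−c} (e^{c} M) = 0`; cancel `e^{−c}`
  have h2 : Real.exp (-(Fintype.card n * t ^ 2 / 2)) *
      ((∫ φ : n → ℝ, (∑ b, φ b) * Real.exp (t * ∑ b, φ b) *
        (Real.exp (∑ b, -(φ b ^ 2 / 2)) * ∏ p : OD n, (φ p.1.1 - φ p.1.2) ^ 2))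
        - Fintype.card n * t * Real.exp (Fintype.card n * t ^ 2 / 2) *
          ∫ φ : n → ℝ, Real.exp (∑ b, -(φ b ^ 2 / 2)) * ∏ p : OD n, (φ p.1.1 - φ p.1.2) ^ 2) = 0 := by
    rw [← htr]
    ring
  rcases mul_eq_zero.1 h2 with h | h
  · exact absurd h hE
  · linarith

/-! ### 2. The second moment of the trace -/

/-- Gaussian domination of the tilted weight: `e^{sΣφ} e^{−Σφ²/2} ≤ e^{Ns²} Π_b e^{−(2/π²)φ_b²}`. -/
theorem exp_mul_sum_mul_gauss_le (s : ℝ) (φ : n → ℝ) :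
    Real.exp (s * ∑ b, φ b) * Real.exp (∑ b, -(φ b ^ 2 / 2))
      ≤ Real.exp (Fintype.card n * s ^ 2) * ∏ b, Real.exp (-(2 / π ^ 2 * φ b ^ 2)) := by
  rw [← Real.exp_add, ← Real.exp_sum, ← Real.exp_add]
  refine Real.exp_le_exp.2 ?_
  have hπ : 2 / π ^ 2 ≤ 1 / 4 := by
    rw [div_le_div_iff₀ (by positivity) (by norm_num)]
    nlinarith [Real.pi_gt_three]
  have hterm : ∀ b, s * φ b + -(φ b ^ 2 / 2) ≤ s ^ 2 + -(2 / π ^ 2 * φ b ^ 2) := fun b => by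
    nlinarith [sq_nonneg (φ b / 2 - s), sq_nonneg (φ b), hπ]
  calc s * ∑ b, φ b + ∑ b, -(φ b ^ 2 / 2) = ∑ b, (s * φ b + -(φ b ^ 2 / 2)) := by
        rw [Finset.mul_sum, ← Finset.sum_add_distrib]
    _ ≤ ∑ b, (s ^ 2 + -(2 / π ^ 2 * φ b ^ 2)) := Finset.sum_le_sum fun b _ => hterm b
    _ = Fintype.card n * s ^ 2 + ∑ b, -(2 / π ^ 2 * φ b ^ 2) := by
        rw [Finset.sum_add_distrib, Finset.sum_const, Finset.card_univ, nsmul_eq_mul]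

/-- The second-moment tilted integrand is dominated: `(Σφ)² e^{sΣφ} e^{−Σφ²/2}Δ² ≤ N e^{Ns²} 2^{|OD|} Π e^{−(2/π²)φ²}(1+φ²)^{|OD|+2}`. -/
theorem sumSq_mul_exp_mul_gaussVandermonde_le (s : ℝ) (φ : n → ℝ) :
    (∑ b, φ b) ^ 2 * Real.exp (s * ∑ b, φ b) * (Real.exp (∑ b, -(φ b ^ 2 / 2)) * ∏ p : OD n, (φ p.1.1 - φ p.1.2) ^ 2)
      ≤ Fintype.card n * Real.exp (Fintype.card n * s ^ 2) * 2 ^ Fintype.card (OD n) *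
        ∏ b, (Real.exp (-(2 / π ^ 2 * φ b ^ 2)) * (1 + φ b ^ 2) ^ (Fintype.card (OD n) + 2)) := by
  have hCS : (∑ b, φ b) ^ 2 ≤ Fintype.card n * ∑ b, φ b ^ 2 := by
    have h := sq_sum_le_card_mul_sum_sq (s := (Finset.univ : Finset n)) (f := fun b => φ b)
    simpa using h
  have hS : (∑ b, φ b) ^ 2 ≤ Fintype.card n * (∏ b, (1 + φ b ^ 2)) ^ 2 := by
    refine hCS.trans (mul_le_mul_of_nonneg_left ?_ (Nat.cast_nonneg _))
    have h1 := sum_sq_le_prod_one_add_sq φ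
    have hP : 1 ≤ ∏ b, (1 + φ b ^ 2) := Finset.one_le_prod fun k _ => by nlinarith [sq_nonneg (φ k)]
    nlinarith
  have h := mul_prod_le_laplaceBound φ (le_refl (∏ b, Real.exp (-(2 / π ^ 2 * φ b ^ 2))))
    (fun p => sq_nonneg _) (fun p => le_rfl)
  have hK := exp_mul_sum_mul_gauss_le s φ
  calc (∑ b, φ b) ^ 2 * Real.exp (s * ∑ b, φ b) * (Real.exp (∑ b, -(φ b ^ 2 / 2)) * ∏ p : OD n, (φ p.1.1 - φ p.1.2) ^ 2)
      = (∑ b, φ b) ^ 2 * ((Real.exp (s * ∑ b, φ b) * Real.exp (∑ b, -(φ b ^ 2 / 2))) *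
          ∏ p : OD n, (φ p.1.1 - φ p.1.2) ^ 2) := by ring
    _ ≤ (Fintype.card n * (∏ b, (1 + φ b ^ 2)) ^ 2) * ((Real.exp (Fintype.card n * s ^ 2) *
          ∏ b, Real.exp (-(2 / π ^ 2 * φ b ^ 2))) * ∏ p : OD n, (φ p.1.1 - φ p.1.2) ^ 2) :=
        mul_le_mul hS (mul_le_mul_of_nonneg_right hK (Finset.prod_nonneg fun p _ => sq_nonneg _))
          (mul_nonneg (mul_nonneg (Real.exp_nonneg _) (Real.exp_nonneg _)) (Finset.prod_nonneg fun p _ => sq_nonneg _))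
          (by positivity)
    _ = Fintype.card n * Real.exp (Fintype.card n * s ^ 2) * ((∏ b, (1 + φ b ^ 2)) ^ 2 *
          ((∏ b, Real.exp (-(2 / π ^ 2 * φ b ^ 2))) * ∏ p : OD n, (φ p.1.1 - φ p.1.2) ^ 2)) := by ring
    _ ≤ Fintype.card n * Real.exp (Fintype.card n * s ^ 2) * ((∏ b, (1 + φ b ^ 2)) ^ 2 *
          (2 ^ Fintype.card (OD n) * ∏ b, (Real.exp (-(2 / π ^ 2 * φ b ^ 2)) * (1 + φ b ^ 2) ^ Fintype.card (OD n)))) :=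
        mul_le_mul_of_nonneg_left (mul_le_mul_of_nonneg_left h (by positivity)) (by positivity)
    _ = Fintype.card n * Real.exp (Fintype.card n * s ^ 2) * 2 ^ Fintype.card (OD n) *
        ∏ b, (Real.exp (-(2 / π ^ 2 * φ b ^ 2)) * (1 + φ b ^ 2) ^ (Fintype.card (OD n) + 2)) := by
        rw [← Finset.prod_pow, mul_left_comm (∏ b, (1 + φ b ^ 2) ^ 2), ← Finset.prod_mul_distrib, ← mul_assoc]
        congr 1
        exact Finset.prod_congr rfl fun b _ => by ring

/-- **`∫ (Σ_bφ_b)² e^{−Σφ²/2} Π_{j≺k}(φ_j − φ_k)² dφ = N · M_N`**: under the normalised Gaussian–Vandermonde law, `Var(Σφ_b) = N`. -/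
theorem integral_sumSq_gaussVandermonde :
    ∫ φ : n → ℝ, (∑ b, φ b) ^ 2 * (Real.exp (∑ b, -(φ b ^ 2 / 2)) * ∏ p : OD n, (φ p.1.1 - φ p.1.2) ^ 2)
      = Fintype.card n * ∫ φ : n → ℝ, Real.exp (∑ b, -(φ b ^ 2 / 2)) * ∏ p : OD n, (φ p.1.1 - φ p.1.2) ^ 2 := by
  set M : ℝ := ∫ φ : n → ℝ, Real.exp (∑ b, -(φ b ^ 2 / 2)) * ∏ p : OD n, (φ p.1.1 - φ p.1.2) ^ 2 with hM
  set F : ℝ → (n → ℝ) → ℝ := fun t φ => (∑ b, φ b) * Real.exp (t * ∑ b, φ b) * (Real.exp (∑ b, -(φ b ^ 2 / 2)) * ∏ p : OD n, (φ p.1.1 - φ p.1.2) ^ 2) with hF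
  set F' : ℝ → (n → ℝ) → ℝ := fun t φ => (∑ b, φ b) ^ 2 * Real.exp (t * ∑ b, φ b) * (Real.exp (∑ b, -(φ b ^ 2 / 2)) * ∏ p : OD n, (φ p.1.1 - φ p.1.2) ^ 2) with hF'
  have hcont : ∀ t, Continuous (F t) := fun t => by simp only [hF]; fun_prop
  have hcont' : ∀ t, Continuous (F' t) := fun t => by simp only [hF']; fun_prop
  have hderiv : ∀ φ : n → ℝ, ∀ t : ℝ, HasDerivAt (fun s => F s φ) (F' t φ) t := by
    intro φ t
    simp only [hF, hF']
    have h1 : HasDerivAt (fun s : ℝ => Real.exp (s * ∑ b, φ b)) (Real.exp (t * ∑ b, φ b) * ∑ b, φ b) t := by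
      have h := ((hasDerivAt_id t).mul_const (∑ b, φ b)).exp
      simpa using h
    have h2 := (h1.const_mul (∑ b, φ b)).mul_const (Real.exp (∑ b, -(φ b ^ 2 / 2)) * ∏ p : OD n, (φ p.1.1 - φ p.1.2) ^ 2)
    refine h2.congr_deriv ?_
    ring
  -- domination on `t ∈ (−1, 1)` by the sum of the two tilted bounds at `s = ±1`
  have hbound : ∀ φ : n → ℝ, ∀ t ∈ Set.Ioo (-1 : ℝ) 1, ‖F' t φ‖
      ≤ (∑ b, φ b) ^ 2 * Real.exp (1 * ∑ b, φ b) * (Real.exp (∑ b, -(φ b ^ 2 / 2)) * ∏ p : OD n, (φ p.1.1 - φ p.1.2) ^ 2) + (∑ b, φ b) ^ 2 * Real.exp (-1 * ∑ b, φ b) * (Real.exp (∑ b, -(φ b ^ 2 / 2)) * ∏ p : OD n, (φ p.1.1 - φ p.1.2) ^ 2) := by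
    intro φ t ht
    simp only [hF', Real.norm_eq_abs]
    have hG0 : 0 ≤ (Real.exp (∑ b, -(φ b ^ 2 / 2)) * ∏ p : OD n, (φ p.1.1 - φ p.1.2) ^ 2) := mul_nonneg (Real.exp_nonneg _) (Finset.prod_nonneg fun p _ => sq_nonneg _)
    rw [abs_of_nonneg (mul_nonneg (mul_nonneg (sq_nonneg _) (Real.exp_nonneg _)) hG0), ← add_mul, ← mul_add]
    refine mul_le_mul_of_nonneg_right (mul_le_mul_of_nonneg_left ?_ (sq_nonneg _)) hG0
    -- `e^{tS} ≤ e^{S} + e^{−S}` for `|t| < 1`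
    set S : ℝ := ∑ b, φ b
    rcases le_total 0 S with hS | hS
    · have : Real.exp (t * S) ≤ Real.exp (1 * S) := Real.exp_le_exp.2 (by nlinarith [ht.2])
      linarith [Real.exp_pos (-1 * S)]
    · have : Real.exp (t * S) ≤ Real.exp (-1 * S) := Real.exp_le_exp.2 (by nlinarith [ht.1])
      linarith [Real.exp_pos (1 * S)]
  have hintF' : ∀ s : ℝ, Integrable (fun φ : n → ℝ => (∑ b, φ b) ^ 2 * Real.exp (s * ∑ b, φ b) * (Real.exp (∑ b, -(φ b ^ 2 / 2)) * ∏ p : OD n, (φ p.1.1 - φ p.1.2) ^ 2)) := by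
    intro s
    refine Integrable.mono' (integrable_gaussPolyBound (Fintype.card n * Real.exp (Fintype.card n * s ^ 2) *
      2 ^ Fintype.card (OD n)) (Fintype.card (OD n) + 2))
      (by fun_prop : Continuous fun φ : n → ℝ => (∑ b, φ b) ^ 2 * Real.exp (s * ∑ b, φ b) * (Real.exp (∑ b, -(φ b ^ 2 / 2)) * ∏ p : OD n, (φ p.1.1 - φ p.1.2) ^ 2)).aestronglyMeasurable
      (Eventually.of_forall fun φ => ?_)
    rw [Real.norm_eq_abs, abs_of_nonneg (mul_nonneg (mul_nonneg (sq_nonneg _) (Real.exp_nonneg _))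
      (mul_nonneg (Real.exp_nonneg _) (Finset.prod_nonneg fun p _ => sq_nonneg _)))]
    exact sumSq_mul_exp_mul_gaussVandermonde_le s φ
  have hint0 : Integrable (F 0) := by
    -- `|F 0| ≤ (1 + (Σφ)²) G ≤ G-bound + F'-bound`
    refine Integrable.mono' ((integrable_laplaceBound (n := n)).add (hintF' 0)) (hcont 0).aestronglyMeasurable
      (Eventually.of_forall fun φ => ?_)
    simp only [hF, zero_mul, Real.exp_zero, mul_one, Real.norm_eq_abs, Pi.add_apply]
    have hG0 : 0 ≤ (Real.exp (∑ b, -(φ b ^ 2 / 2)) * ∏ p : OD n, (φ p.1.1 - φ p.1.2) ^ 2) := mul_nonneg (Real.exp_nonneg _) (Finset.prod_nonneg fun p _ => sq_nonneg _)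
    rw [abs_mul, abs_of_nonneg hG0]
    have hG1 : (Real.exp (∑ b, -(φ b ^ 2 / 2)) * ∏ p : OD n, (φ p.1.1 - φ p.1.2) ^ 2) ≤ 2 ^ Fintype.card (OD n) * ∏ b, (Real.exp (-(2 / π ^ 2 * φ b ^ 2)) * (1 + φ b ^ 2) ^ Fintype.card (OD n)) := by
      refine mul_prod_le_laplaceBound φ ?_ (fun p => sq_nonneg _) (fun p => le_rfl)
      rw [← Real.exp_sum]
      refine Real.exp_le_exp.2 (Finset.sum_le_sum fun b _ => ?_)
      have hπ : 2 / π ^ 2 ≤ 1 / 2 := by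
        rw [div_le_div_iff₀ (by positivity) (by norm_num)]
        nlinarith [Real.pi_gt_three]
      nlinarith [sq_nonneg (φ b)]
    have hab : |∑ b, φ b| ≤ 1 + (∑ b, φ b) ^ 2 := by nlinarith [abs_nonneg (∑ b, φ b), sq_abs (∑ b, φ b), sq_nonneg (|∑ b, φ b| - 1)]
    calc |∑ b, φ b| * (Real.exp (∑ b, -(φ b ^ 2 / 2)) * ∏ p : OD n, (φ p.1.1 - φ p.1.2) ^ 2)
        ≤ (1 + (∑ b, φ b) ^ 2) * (Real.exp (∑ b, -(φ b ^ 2 / 2)) * ∏ p : OD n, (φ p.1.1 - φ p.1.2) ^ 2) := mul_le_mul_of_nonneg_right hab hG0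
      _ = (Real.exp (∑ b, -(φ b ^ 2 / 2)) * ∏ p : OD n, (φ p.1.1 - φ p.1.2) ^ 2) + (∑ b, φ b) ^ 2 * (Real.exp (∑ b, -(φ b ^ 2 / 2)) * ∏ p : OD n, (φ p.1.1 - φ p.1.2) ^ 2) := by ring
      _ ≤ _ := add_le_add hG1 le_rfl
  have hD := hasDerivAt_integral_of_dominated_loc_of_deriv_le (μ := (volume : Measure (n → ℝ))) (x₀ := (0 : ℝ))
    (F := F) (F' := F') (s := Set.Ioo (-1 : ℝ) 1) (Ioo_mem_nhds (by norm_num) (by norm_num))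
    (Eventually.of_forall fun t => (hcont t).aestronglyMeasurable) hint0 (hcont' 0).aestronglyMeasurable
    (Eventually.of_forall fun φ t ht => hbound φ t ht) ((hintF' 1).add (hintF' (-1)))
    (Eventually.of_forall fun φ t _ => hderiv φ t)
  -- the closed form `∫ F t = N t e^{Nt²/2} M` and its derivative `N M` at `t = 0`
  have hclosed : (fun t : ℝ => ∫ φ, F t φ) = fun t => Fintype.card n * t * Real.exp (Fintype.card n * t ^ 2 / 2) * M := by
    funext t
    exact integral_sum_mul_exp_mul_sum_gaussVandermonde t
  have hD2 : HasDerivAt (fun t : ℝ => ∫ φ, F t φ) (Fintype.card n * M) 0 := by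
    rw [hclosed]
    have h1 : HasDerivAt (fun t : ℝ => Fintype.card n * t) (Fintype.card n : ℝ) 0 := by
      simpa using (hasDerivAt_id (0 : ℝ)).const_mul (Fintype.card n : ℝ)
    have h2 : HasDerivAt (fun t : ℝ => Real.exp (Fintype.card n * t ^ 2 / 2))
        (Real.exp (Fintype.card n * (0 : ℝ) ^ 2 / 2) * (Fintype.card n * (2 * 0) / 2)) 0 := by
      have h := (((hasDerivAt_pow 2 (0 : ℝ)).const_mul (Fintype.card n : ℝ)).div_const 2).exp
      simpa using h
    have h := (h1.mul h2).mul_const M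
    refine h.congr_deriv ?_
    simp
  have huniq := hD.2.unique hD2
  simpa only [hF', zero_mul, Real.exp_zero, mul_one] using huniq

end TraceMoment

end Summit.Ventures.LatticeQCDFlow.Scoring
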